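import Mathlib
import HarnessLib

/-!
# Kottwitz 1992, §6 «Hecke correspondences and λ-adic sheaves» — statements as printed (carpet, no proofs)

[Kottwitz1992] R. E. Kottwitz, *Points on some Shimura varieties over finite fields*, J. Amer. Math.
Soc. **5** (1992) 373–444, §6, pp. 392–393.  SOURCE READ: held text `paper:doi-10-2307-2152772`
(pdf page `p00NN` = printed page `372 + NN`; §6 = p0020 L40 – p0021 L25).  Squad TK (HCML «GO 500»,
seat TK-t03), target `Literature/NumberTheory/Kottwitz1992/HeckeCorrespondences.lean`.

§6 contains NO numbered statement; it fixes the formal apparatus used in §§16–19: the tower of moduli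
spaces `S_{K^p}` (`K^p ⊂ G(𝔸_f^p)` compact open, small), its covering maps, the isomorphisms
`S_{K^p} → S_{g⁻¹K^pg}` «sending `(A, λ, i, η̄)` to `(A, λ, i, η̄g)`», the `λ`-adic sheaves `ℱ_{K^p}`
attached to a representation `ξ` of `G`, and the Hecke correspondence
`S_{K^p} ←a– S_{K^p_g} –b→ S_{K^p}`, `K^p_g = K^p ∩ gK^pg⁻¹`, extended to `ℱ`.  The load-bearing
assertions are typed below AT THE LEVEL OF POINTS, which is where §§16, 19 use them (fixed points of
`Φ_𝔭^j ∘ f` are counted on `S_{K^p}(k̄)`).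

## The carrier, and what it stands for

By §5 (p. 391, p0019 L1–L12) a level structure of type `K^p` on `(A, λ, i)` is a `K^p`-ORBIT `η̄` of
isomorphisms `η : V ⊗ 𝔸_f^p → H₁(A, 𝔸_f^p)` of skew-Hermitian `B`-modules, and «the similitude group
`G(𝔸_f^p)` acts on the right of the set of isomorphisms `η`, simply transitively if this set is nonempty;
this explains what was meant by a `K^p`-orbit of isomorphisms `η`».  Accordingly the file works with

  ⟨CARRIER⟩ a group `𝒢` (for `G(𝔸_f^p)`) acting ON THE RIGHT (Mathlib: `MulAction 𝒢ᵐᵒᵖ X`,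
  `x·g = MulOpposite.op g • x`) on a type `X` (for the isomorphism classes of quadruples `(A, λ, i, η)`
  with a FULL level structure `η` over a fixed base),

so that the points of `S_{K^p}` are the `K^p`-orbits `levelQuotient K X` and every map of §6 is given
by the printed formula on representatives.  «We only consider compact open subgroups `K^p` … small
enough so that the objects in the moduli problem have no nontrivial automorphisms» (p. 392, p0020
L41–L43) becomes the hypothesis `ActsFreely K X` where a statement needs it.  The coefficient
representation «`ξ` … on a vector space over a number field `L`, … `λ` a place of `L` lying over `l`.
Then `ξ` gives a `λ`-adic representation of `G(ℚ_l)` and hence of `G(𝔸_f^p)`» (p. 393, p0021 L10–L14)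
is any Mathlib `Representation R 𝒢 W`; the sheaf `ℱ_{K^p}` is modelled by its total space
`(X × W)/K^p` for the diagonal right action `(x, w)·k = (x·k, ξ(k)⁻¹ w)`, presented through the
relation `SheafRel` (no quotient is formed, so no well-definedness proof is needed).

NOT TYPED (no Lean vocabulary: étale site, smooth `l`-adic sheaves): that `S_{K^p_1} → S_{K^p}` is an
ÉTALE covering of schemes, that `ℱ_{K^p}` is a SMOOTH `λ`-adic sheaf, and the scheme structure of the
Hecke correspondence; only their effect on points ∕ fibres is recorded.  Dedup: `rg 'Kottwitz1992, §6'`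
finds no tree file; the tree's `Literature.AlgebraicGeometry.ShimuraVarieties.HeckeCorrespondenceAction`
is the analytic ball-quotient operator `T_g` on Betti cohomology (a different object) and is not restated.
Nothing is proved; every `def … : Prop` is a predicate on the carrier, `∀ data, P data` is not claimed.
-/

namespace Literature.NumberTheory.Kottwitz1992.HeckeCorrespondences

variable {𝒢 : Type} [Group 𝒢] (X : Type) [MulAction 𝒢ᵐᵒᵖ X]

/-- The points of `S_K`: the set of `K`-orbits of the right `𝒢`-set `X` of quadruples with full level
structure («`η̄` is a `K^p`-orbit of isomorphisms `η`», §5 p. 391; `S_{K^p}` p. 391).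
[cite: Kottwitz1992, §5 (p. 391) and §6 (p. 392)] -/
abbrev levelQuotient (K : Subgroup 𝒢) : Type :=
  MulAction.orbitRel.Quotient K.op X

/-- `(A, λ, i, η) ↦ (A, λ, i, η̄)`: the class of a full-level point in `S_K`.
[cite: Kottwitz1992, §6 (p. 392)] -/
abbrev proj (K : Subgroup 𝒢) (x : X) : levelQuotient X K :=
  Quotient.mk (MulAction.orbitRel K.op X) x

/-- `K` is «small enough so that the objects in the moduli problem have no nontrivial automorphisms»
(p. 392): read on points, `K` acts freely on `X`. [cite: Kottwitz1992, §6 (p. 392)] -/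
def ActsFreely (K : Subgroup 𝒢) : Prop :=
  ∀ (k : 𝒢) (x : X), k ∈ K → MulOpposite.op k • x = x → k = 1

/-- The conjugate subgroup `g⁻¹ K g`. [cite: Kottwitz1992, §6 (p. 392), «`S_{g⁻¹K^pg}`»] -/
def conjSubgroup (g : 𝒢) (K : Subgroup 𝒢) : Subgroup 𝒢 :=
  K.map (MulAut.conj g⁻¹).toMonoidHom

/-- `K_g := K ∩ g K g⁻¹` (p. 393: «Put `K^p_g = K^p ∩ gK^pg⁻¹`»). [cite: Kottwitz1992, §6 (p. 393)] -/
def heckeSubgroup (g : 𝒢) (K : Subgroup 𝒢) : Subgroup 𝒢 :=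
  K ⊓ K.map (MulAut.conj g).toMonoidHom

/-- **[Kottwitz1992, §6 (p. 392)] the covering `S_{K^p_1} → S_{K^p}`**, verbatim (p0020 L43–L48):
«For any compact open subgroup `K^p_1` of `K^p` there is an etale covering `S_{K^p_1} → S_{K^p}`,
sending `(A, λ, i, (η̄)₁)` to `(A, λ, i, η̄)`, where `(η̄)₁` denotes the `K^p_1`-orbit of `η`, and this
covering map is Galois with Galois group `K^p/K^p_1` if `K^p_1` is normal in `K^p`.»
TYPED on points: for `K₁ ≤ K` there is a map `f : S_{K₁} → S_K` with `f [x]_{K₁} = [x]_K`, it is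
surjective, and — if `K₁` is normal in `K` and `K` is small (`ActsFreely`) — `x ↦ x·k` (`k ∈ K`) descends
to `S_{K₁}`, and `K` acts through it transitively on each fibre of `f` with stabiliser exactly `K₁` (so the
fibres are `K/K₁`-torsors: «Galois with Galois group `K^p/K^p_1`»).  «etale» is not
typed. [cite: Kottwitz1992, §6 (p. 392)] -/
def Kottwitz1992_6_covering (K₁ K : Subgroup 𝒢) : Prop :=
  K₁ ≤ K →
    (∃ f : levelQuotient X K₁ → levelQuotient X K,
      (∀ x : X, f (proj X K₁ x) = proj X K x) ∧ Function.Surjective f) ∧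
    ((K₁.subgroupOf K).Normal → ActsFreely X K →
      (∀ (x x' : X) (k : 𝒢), k ∈ K → proj X K₁ x = proj X K₁ x' →
        proj X K₁ (MulOpposite.op k • x) = proj X K₁ (MulOpposite.op k • x')) ∧
      (∀ x x' : X, proj X K x = proj X K x' → ∃ k ∈ K, proj X K₁ (MulOpposite.op k • x) = proj X K₁ x') ∧
      (∀ (x : X) (k k' : 𝒢), k ∈ K → k' ∈ K →
        (proj X K₁ (MulOpposite.op k • x) = proj X K₁ (MulOpposite.op k' • x) ↔ k⁻¹ * k' ∈ K₁)))

/-- **[Kottwitz1992, §6 (p. 392)] the isomorphism `S_{K^p} → S_{g⁻¹K^pg}`**, verbatim (p0020 L48–L49):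
«For `g ∈ G(𝔸_f^p)` there is an isomorphism `S_{K^p} → S_{g⁻¹K^pg}` sending `(A, λ, i, η̄)` to
`(A, λ, i, η̄g)`.»  TYPED on points: a bijection `S_K ≃ S_{g⁻¹Kg}` with `[x]_K ↦ [x·g]_{g⁻¹Kg}`.
[cite: Kottwitz1992, §6 (p. 392)] -/
def Kottwitz1992_6_translate (g : 𝒢) (K : Subgroup 𝒢) : Prop :=
  ∃ f : levelQuotient X K ≃ levelQuotient X (conjSubgroup g K),
    ∀ x : X, f (proj X K x) = proj X (conjSubgroup g K) (MulOpposite.op g • x)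

/-- **[Kottwitz1992, §6 (p. 393)] the Hecke correspondence**, verbatim (p0021 L15–L21): «Let `K^p` be a
sufficiently small compact open subgroup of `G(𝔸_f^p)` and let `g ∈ G(𝔸_f^p)`. Put `K^p_g = K^p ∩ gK^pg⁻¹`.
Then we get a Hecke correspondence from `S_{K^p}` to itself by taking `S_{K^p} ←a– S_{K^p_g} –b→ S_{K^p}`
where the map `a` is the composition of the covering map `S_{K^p} ← S_{g⁻¹(K^p_g)g}` for the inclusion
`g⁻¹(K^p_g)g ⊂ K^p` and the canonical isomorphism `S_{g⁻¹(K^p_g)g} ← S_{K^p_g}` induced by `g` and the map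
`b` is the covering map for the inclusion `K^p_g ⊂ K^p`.»  TYPED on points: there are maps
`a, b : S_{K_g} → S_K` with `a [x]_{K_g} = [x·g]_K` and `b [x]_{K_g} = [x]_K`.
[cite: Kottwitz1992, §6 (p. 393)] -/
def Kottwitz1992_6_heckeCorrespondence (g : 𝒢) (K : Subgroup 𝒢) : Prop :=
  ∃ a b : levelQuotient X (heckeSubgroup g K) → levelQuotient X K,
    (∀ x : X, a (proj X (heckeSubgroup g K) x) = proj X K (MulOpposite.op g • x)) ∧
    (∀ x : X, b (proj X (heckeSubgroup g K) x) = proj X K x)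

/-! ## The `λ`-adic sheaves `ℱ_{K^p}` on points: total space `(X × W)/K` -/

variable {R W : Type} [CommRing R] [AddCommGroup W] [Module R W] (ξ : Representation R 𝒢 W)

/-- The relation presenting the total space of `ℱ_K` as `(X × W)/K`: `(x, w) ~_K (x·k, ξ(k)⁻¹ w)` for
`k ∈ K` («use the restriction of the `l`-adic representation to `K^p` and the tower over `S_{K^p}` with
Galois group `K^p` to construct `ℱ_{K^p}`», p. 393, p0021 L5–L7).
[cite: Kottwitz1992, §6 (p. 393)] -/
def SheafRel (K : Subgroup 𝒢) (q q' : X × W) : Prop :=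
  ∃ k ∈ K, q'.1 = MulOpposite.op k • q.1 ∧ q'.2 = ξ k⁻¹ q.2

/-- **[Kottwitz1992, §6 (p. 393)] the sheaf `ℱ_{K^p}` and its fibres**, verbatim (p0020 L50 – p0021 L7):
«any continuous `l`-adic representation of `G(𝔸_f^p)` gives rise to smooth `l`-adic sheaves `ℱ_{K^p}` on
`S_{K^p}`».  TYPED on points, for `K` small: `~_K` is an equivalence relation on `X × W` lying over the
orbit relation on `X`, and on each fibre `{x} × W` it is the identity — so the fibre of
`(X × W)/K → S_K` at `[x]` is `W` (via `w ↦ [(x, w)]`).  «smooth», «`l`-adic» are not typed.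
[cite: Kottwitz1992, §6 (p. 393)] -/
def Kottwitz1992_6_sheaf_fibre (K : Subgroup 𝒢) : Prop :=
  ActsFreely X K →
    Equivalence (SheafRel X ξ K) ∧
    (∀ q q' : X × W, SheafRel X ξ K q q' → proj X K q.1 = proj X K q'.1) ∧
    (∀ (x : X) (w w' : W), SheafRel X ξ K (x, w) (x, w') → w = w')

/-- **[Kottwitz1992, §6 (p. 393)] pull-back along the covering**, verbatim (p0021 L7–L8): «the pullback of
`ℱ_{K^p}` under `S_{K^p_1} → S_{K^p}` is canonically isomorphic to `ℱ_{K^p_1}`».  TYPED on points, for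
`K₁ ≤ K` and `K` small: the identity of `X × W` induces a map `(X × W)/K₁ → (X × W)/K` over
`S_{K₁} → S_K` (`~_{K₁} ⊆ ~_K`) which is a bijection on fibres: two `~_K`-equivalent pairs whose first
components are `~_{K₁}`-equivalent are `~_{K₁}`-equivalent. [cite: Kottwitz1992, §6 (p. 393)] -/
def Kottwitz1992_6_sheaf_pullback_covering (K₁ K : Subgroup 𝒢) : Prop :=
  K₁ ≤ K → ActsFreely X K →
    (∀ q q' : X × W, SheafRel X ξ K₁ q q' → SheafRel X ξ K q q') ∧
    (∀ q q' : X × W, SheafRel X ξ K q q' → proj X K₁ q.1 = proj X K₁ q'.1 → SheafRel X ξ K₁ q q')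

/-- **[Kottwitz1992, §6 (p. 393)] pull-back along `S_{K^p} → S_{g⁻¹K^pg}`**, verbatim (p0021 L8–L9):
«the pullback of `ℱ_{g⁻¹K^pg}` under `S_{K^p} → S_{g⁻¹K^pg}` is canonically isomorphic to `ℱ_{K^p}`; of
course this isomorphism depends on the element `g` and not just the subgroup `g⁻¹K^pg`».  TYPED on
points: the map `(x, w) ↦ (x·g, ξ(g)⁻¹ w)` carries `~_K` onto `~_{g⁻¹Kg}` (both directions), hence
induces a bijection `(X × W)/K → (X × W)/g⁻¹Kg` covering `[x] ↦ [x·g]`; the formula exhibits the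
dependence on `g`. [cite: Kottwitz1992, §6 (p. 393)] -/
def Kottwitz1992_6_sheaf_pullback_translate (g : 𝒢) (K : Subgroup 𝒢) : Prop :=
  ∀ q q' : X × W,
    SheafRel X ξ K q q' ↔
      SheafRel X ξ (conjSubgroup g K) (MulOpposite.op g • q.1, ξ g⁻¹ q.2)
        (MulOpposite.op g • q'.1, ξ g⁻¹ q'.2)

/-- **[Kottwitz1992, §6 (p. 393)] the Hecke correspondence on `ℱ`**, verbatim (p0021 L22–L25): «This
Hecke correspondence extends naturally to the sheaf `ℱ_{K^p}`. For this we need a canonical map from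
`b*ℱ_{K^p}` to `a*ℱ_{K^p}`; since both pullbacks are canonically isomorphic to `ℱ_{K^p_g}`, we simply take
the canonical isomorphism between the two pullbacks as our map.»  TYPED on points: with `K_g = K ∩ gKg⁻¹`,
the identity (for `b`, `K_g ≤ K`) and `(x, w) ↦ (x·g, ξ(g)⁻¹ w)` (for `a`, `K_g ≤ gKg⁻¹` i.e.
`g⁻¹K_gg ≤ K`) both respect `~_{K_g}` into `~_K`, giving the two maps `(X × W)/K_g → (X × W)/K` over
`b` and `a`. [cite: Kottwitz1992, §6 (p. 393)] -/
def Kottwitz1992_6_sheaf_heckeCorrespondence (g : 𝒢) (K : Subgroup 𝒢) : Prop :=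
  (∀ q q' : X × W, SheafRel X ξ (heckeSubgroup g K) q q' → SheafRel X ξ K q q') ∧
  (∀ q q' : X × W, SheafRel X ξ (heckeSubgroup g K) q q' →
    SheafRel X ξ K (MulOpposite.op g • q.1, ξ g⁻¹ q.2) (MulOpposite.op g • q'.1, ξ g⁻¹ q'.2))


/-! ## ED. 2 (TK-t03, paydown): the points-level statements above are PROVABLE in the orbit-set model — proofs

Squad ruling (TK-plan 02:30Z, after the gate's review of p847977: D-0026 (iv) «provable in your own concrete model ⇒
theorem»): each `def Kottwitz1992_6_X : Prop` above gets `theorem Kottwitz1992_6_X_holds` here, with the def's own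
parameters and no further hypothesis.  ED. 1 is byte-identical above this line. -/

section Holds

variable {X}

/-- Two full-level points have the same class in `S_K` iff they differ by an element of `K` (acting on the right).
[cite: Kottwitz1992, §5 (p. 391)] -/
theorem proj_eq_iff {K : Subgroup 𝒢} {x y : X} :
    proj X K x = proj X K y ↔ ∃ k ∈ K, MulOpposite.op k • y = x := by
  rw [proj, proj, Quotient.eq]
  change x ∈ MulAction.orbit (↥K.op) y ↔ _
  constructor
  · rintro ⟨⟨k, hk⟩, rfl⟩
    exact ⟨MulOpposite.unop k, Subgroup.mem_op.mp hk, rfl⟩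
  · rintro ⟨k, hk, rfl⟩
    exact ⟨⟨MulOpposite.op k, Subgroup.mem_op.mpr hk⟩, rfl⟩

/-- `x·k·g = (x·g)·(g⁻¹kg)`: moving `g` past `k` on the right. [cite: Kottwitz1992, §6 (p. 392)] -/
theorem op_smul_op_smul (g k : 𝒢) (x : X) :
    MulOpposite.op g • MulOpposite.op k • x =
      MulOpposite.op (g⁻¹ * k * g) • MulOpposite.op g • x := by
  simp only [← mul_smul, ← MulOpposite.op_mul]
  congr 1
  simp [mul_assoc]

/-- Membership in `g⁻¹ K g` («`S_{g⁻¹K^pg}`», p. 392): `k ∈ g⁻¹Kg ↔ g k g⁻¹ ∈ K`. [cite: Kottwitz1992, §6 (p. 392)] -/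
theorem mem_conjSubgroup_iff {g k : 𝒢} {K : Subgroup 𝒢} :
    k ∈ conjSubgroup g K ↔ g * k * g⁻¹ ∈ K := by
  constructor
  · rintro ⟨k₀, hk₀, rfl⟩
    simpa [MulAut.conj_apply, mul_assoc] using hk₀
  · intro h
    exact ⟨g * k * g⁻¹, h, by simp [mul_assoc]⟩

/-- Membership in `K_g = K ∩ gKg⁻¹` (p. 393): `k ∈ K_g ↔ k ∈ K ∧ g⁻¹ k g ∈ K`. [cite: Kottwitz1992, §6 (p. 393)] -/
theorem mem_heckeSubgroup_iff {g k : 𝒢} {K : Subgroup 𝒢} :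
    k ∈ heckeSubgroup g K ↔ k ∈ K ∧ g⁻¹ * k * g ∈ K := by
  simp only [heckeSubgroup, Subgroup.mem_inf, and_congr_right_iff]
  intro _
  constructor
  · rintro ⟨k₀, hk₀, rfl⟩
    simpa [MulAut.conj_apply, mul_assoc] using hk₀
  · intro h
    exact ⟨g⁻¹ * k * g, h, by simp [MulAut.conj_apply, mul_assoc]⟩

/-- **(p. 392) the covering `S_{K₁} → S_K`** — PROVED on points. [cite: Kottwitz1992, §6 (p. 392)] -/
theorem Kottwitz1992_6_covering_holds : ∀ K₁ K : Subgroup 𝒢, Kottwitz1992_6_covering X K₁ K := by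
  intro K₁ K hle
  refine ⟨?_, ?_⟩
  · refine ⟨Quotient.lift (proj X K) (fun x y hxy => ?_), fun x => rfl, ?_⟩
    · obtain ⟨⟨k, hk⟩, rfl⟩ := hxy
      exact (proj_eq_iff (X := X)).mpr ⟨MulOpposite.unop k, hle (Subgroup.mem_op.mp hk), rfl⟩
    · intro q
      induction q using Quotient.inductionOn with
      | h x => exact ⟨proj X K₁ x, rfl⟩
  · intro hN hfree
    refine ⟨?_, ?_, ?_⟩
    · intro x x' k hk hxx'
      obtain ⟨k₁, hk₁, rfl⟩ := (proj_eq_iff (X := X)).mp hxx'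
      refine (proj_eq_iff (X := X)).mpr ⟨k⁻¹ * k₁ * k, ?_, ?_⟩
      · have := hN.conj_mem ⟨k₁, hle hk₁⟩ (Subgroup.mem_subgroupOf.mpr (by simpa using hk₁)) ⟨k⁻¹, K.inv_mem hk⟩
        simpa [Subgroup.mem_subgroupOf, mul_assoc] using this
      · simp only [← mul_smul, ← MulOpposite.op_mul]
        congr 1
        simp [mul_assoc]
    · intro x x' hxx'
      obtain ⟨k, hk, rfl⟩ := (proj_eq_iff (X := X)).mp hxx'.symm
      exact ⟨k, hk, rfl⟩
    · intro x k k' hk hk'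
      rw [proj_eq_iff]
      constructor
      · rintro ⟨k₁, hk₁, h⟩
        have h' : MulOpposite.op (k' * k₁ * k⁻¹) • x = x := by
          have := congrArg (fun y => MulOpposite.op k⁻¹ • y) h
          simpa only [← mul_smul, ← MulOpposite.op_mul, mul_inv_cancel, MulOpposite.op_one, one_smul,
            mul_assoc] using this
        have hmem : k' * k₁ * k⁻¹ ∈ K := K.mul_mem (K.mul_mem hk' (hle hk₁)) (K.inv_mem hk)
        have h1 := hfree _ x hmem h'
        have : k₁ = k'⁻¹ * k := by
          have := congrArg (fun y => k'⁻¹ * y * k) h1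
          simpa [mul_assoc] using this
        rw [this] at hk₁
        simpa using K₁.inv_mem hk₁
      · intro h
        refine ⟨k'⁻¹ * k, ?_, ?_⟩
        · simpa using K₁.inv_mem h
        · simp only [← mul_smul, ← MulOpposite.op_mul]
          congr 1
          simp

/-- **(p. 392) the isomorphism `S_K ≃ S_{g⁻¹Kg}`** — PROVED on points. [cite: Kottwitz1992, §6 (p. 392)] -/
theorem Kottwitz1992_6_translate_holds : ∀ (g : 𝒢) (K : Subgroup 𝒢), Kottwitz1992_6_translate X g K := by
  intro g K
  have fwd : ∀ x y : X, proj X K x = proj X K y →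
      proj X (conjSubgroup g K) (MulOpposite.op g • x) = proj X (conjSubgroup g K) (MulOpposite.op g • y) := by
    intro x y h
    obtain ⟨k, hk, rfl⟩ := (proj_eq_iff (X := X)).mp h
    rw [op_smul_op_smul]
    exact (proj_eq_iff (X := X)).mpr ⟨g⁻¹ * k * g, mem_conjSubgroup_iff.mpr (by simpa [mul_assoc] using hk), rfl⟩
  have bwd : ∀ x y : X, proj X (conjSubgroup g K) x = proj X (conjSubgroup g K) y →
      proj X K (MulOpposite.op g⁻¹ • x) = proj X K (MulOpposite.op g⁻¹ • y) := by
    intro x y h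
    obtain ⟨k, hk, rfl⟩ := (proj_eq_iff (X := X)).mp h
    rw [op_smul_op_smul]
    exact (proj_eq_iff (X := X)).mpr ⟨g⁻¹⁻¹ * k * g⁻¹, by simpa using mem_conjSubgroup_iff.mp hk, rfl⟩
  refine ⟨{ toFun := Quotient.lift (fun x => proj X (conjSubgroup g K) (MulOpposite.op g • x))
              (fun x y hxy => fwd x y (Quotient.sound hxy))
            invFun := Quotient.lift (fun x => proj X K (MulOpposite.op g⁻¹ • x))
              (fun x y hxy => bwd x y (Quotient.sound hxy))
            left_inv := ?_, right_inv := ?_ }, fun x => rfl⟩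
  · intro q
    induction q using Quotient.inductionOn with
    | h x =>
      change proj X K (MulOpposite.op g⁻¹ • MulOpposite.op g • x) = proj X K x
      rw [← mul_smul, ← MulOpposite.op_mul, mul_inv_cancel, MulOpposite.op_one, one_smul]
  · intro q
    induction q using Quotient.inductionOn with
    | h x =>
      change proj X (conjSubgroup g K) (MulOpposite.op g • MulOpposite.op g⁻¹ • x) = _
      rw [← mul_smul, ← MulOpposite.op_mul, inv_mul_cancel, MulOpposite.op_one, one_smul]

/-- **(p. 393) the Hecke correspondence `S_K ←a– S_{K_g} –b→ S_K`** — PROVED on points.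
[cite: Kottwitz1992, §6 (p. 393)] -/
theorem Kottwitz1992_6_heckeCorrespondence_holds :
    ∀ (g : 𝒢) (K : Subgroup 𝒢), Kottwitz1992_6_heckeCorrespondence X g K := by
  intro g K
  refine ⟨Quotient.lift (fun x => proj X K (MulOpposite.op g • x)) (fun x y hxy => ?_),
    Quotient.lift (proj X K) (fun x y hxy => ?_), fun x => rfl, fun x => rfl⟩
  · obtain ⟨k, hk, rfl⟩ := (proj_eq_iff (X := X)).mp (Quotient.sound hxy :
      proj X (heckeSubgroup g K) x = proj X (heckeSubgroup g K) y)
    show proj X K _ = proj X K _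
    rw [op_smul_op_smul]
    exact (proj_eq_iff (X := X)).mpr ⟨g⁻¹ * k * g, (mem_heckeSubgroup_iff.mp hk).2, rfl⟩
  · obtain ⟨k, hk, rfl⟩ := (proj_eq_iff (X := X)).mp (Quotient.sound hxy :
      proj X (heckeSubgroup g K) x = proj X (heckeSubgroup g K) y)
    exact (proj_eq_iff (X := X)).mpr ⟨k, (mem_heckeSubgroup_iff.mp hk).1, rfl⟩

variable {R W : Type} [CommRing R] [AddCommGroup W] [Module R W] {ξ : Representation R 𝒢 W}

/-- The `g`-twist `(x, w) ↦ (x·g, ξ(g)⁻¹ w)` transports `~_K`-witnesses `k` to `~_{g⁻¹Kg}`-witnesses `g⁻¹kg`.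
[cite: Kottwitz1992, §6 (p. 393)] -/
theorem sheafRel_twist_of {K K' : Subgroup 𝒢} (g : 𝒢) (hKK' : ∀ k ∈ K, g⁻¹ * k * g ∈ K') {q q' : X × W}
    (h : SheafRel X ξ K q q') :
    SheafRel X ξ K' (MulOpposite.op g • q.1, ξ g⁻¹ q.2) (MulOpposite.op g • q'.1, ξ g⁻¹ q'.2) := by
  obtain ⟨k, hk, h1, h2⟩ := h
  refine ⟨g⁻¹ * k * g, hKK' k hk, ?_, ?_⟩
  · rw [h1, op_smul_op_smul]
  · rw [h2, ← Module.End.mul_apply, ← map_mul, ← Module.End.mul_apply, ← map_mul]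
    simp [mul_assoc]

/-- **(p. 393) `ℱ_K` and its fibres** — PROVED on points. [cite: Kottwitz1992, §6 (p. 393)] -/
theorem Kottwitz1992_6_sheaf_fibre_holds : ∀ K : Subgroup 𝒢, Kottwitz1992_6_sheaf_fibre X ξ K := by
  intro K hfree
  refine ⟨⟨fun q => ⟨1, K.one_mem, by simp, by simp⟩, fun {q q'} h => ?_, fun {q q' q''} h h' => ?_⟩, ?_, ?_⟩
  · obtain ⟨k, hk, h1, h2⟩ := h
    refine ⟨k⁻¹, K.inv_mem hk, ?_, ?_⟩
    · rw [h1, ← mul_smul, ← MulOpposite.op_mul, mul_inv_cancel, MulOpposite.op_one, one_smul]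
    · rw [h2, ← Module.End.mul_apply, ← map_mul, inv_inv, mul_inv_cancel, map_one, Module.End.one_apply]
  · obtain ⟨k, hk, h1, h2⟩ := h
    obtain ⟨k', hk', h1', h2'⟩ := h'
    refine ⟨k * k', K.mul_mem hk hk', ?_, ?_⟩
    · rw [h1', h1, ← mul_smul, ← MulOpposite.op_mul]
    · rw [h2', h2, ← Module.End.mul_apply, ← map_mul, mul_inv_rev]
  · rintro q q' ⟨k, hk, h1, -⟩
    exact ((proj_eq_iff (X := X)).mpr ⟨k, hk, h1.symm⟩).symm
  · rintro x w w' ⟨k, hk, h1, h2⟩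
    have hk1 : k = 1 := hfree k x hk h1.symm
    subst hk1
    simpa using h2.symm

/-- **(p. 393) pull-back along the covering** — PROVED on points. [cite: Kottwitz1992, §6 (p. 393)] -/
theorem Kottwitz1992_6_sheaf_pullback_covering_holds :
    ∀ K₁ K : Subgroup 𝒢, Kottwitz1992_6_sheaf_pullback_covering X ξ K₁ K := by
  intro K₁ K hle hfree
  refine ⟨fun q q' ⟨k, hk, h1, h2⟩ => ⟨k, hle hk, h1, h2⟩, ?_⟩
  rintro q q' ⟨k, hk, h1, h2⟩ hproj
  obtain ⟨k₁, hk₁, h1'⟩ := (proj_eq_iff (X := X)).mp hproj.symm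
  have : MulOpposite.op (k * k₁⁻¹) • q.1 = q.1 := by
    have e : MulOpposite.op k • q.1 = MulOpposite.op k₁ • q.1 := by rw [← h1, h1']
    have := congrArg (fun y => MulOpposite.op k₁⁻¹ • y) e
    simpa only [← mul_smul, ← MulOpposite.op_mul, mul_inv_cancel, MulOpposite.op_one, one_smul] using this
  have hk1 : k * k₁⁻¹ = 1 := hfree _ q.1 (K.mul_mem hk (K.inv_mem (hle hk₁))) this
  have : k = k₁ := by simpa using mul_eq_one_iff_eq_inv.mp hk1
  subst this
  exact ⟨k, hk₁, h1, h2⟩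

/-- **(p. 393) pull-back along `S_K → S_{g⁻¹Kg}`** — PROVED on points. [cite: Kottwitz1992, §6 (p. 393)] -/
theorem Kottwitz1992_6_sheaf_pullback_translate_holds :
    ∀ (g : 𝒢) (K : Subgroup 𝒢), Kottwitz1992_6_sheaf_pullback_translate X ξ g K := by
  intro g K q q'
  constructor
  · exact sheafRel_twist_of g (fun k hk => mem_conjSubgroup_iff.mpr (by simpa [mul_assoc] using hk))
  · intro h
    have h' := sheafRel_twist_of (ξ := ξ) (K := conjSubgroup g K) (K' := K) g⁻¹
      (fun k hk => by simpa using mem_conjSubgroup_iff.mp hk) h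
    simpa only [← mul_smul, ← MulOpposite.op_mul, mul_inv_cancel, MulOpposite.op_one, one_smul,
      ← Module.End.mul_apply, ← map_mul, inv_inv, inv_mul_cancel, map_one, Module.End.one_apply] using h'

/-- **(p. 393) the Hecke correspondence on `ℱ`** — PROVED on points. [cite: Kottwitz1992, §6 (p. 393)] -/
theorem Kottwitz1992_6_sheaf_heckeCorrespondence_holds :
    ∀ (g : 𝒢) (K : Subgroup 𝒢), Kottwitz1992_6_sheaf_heckeCorrespondence X ξ g K := by
  intro g K
  refine ⟨fun q q' ⟨k, hk, h1, h2⟩ => ⟨k, (mem_heckeSubgroup_iff.mp hk).1, h1, h2⟩, fun q q' h => ?_⟩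
  exact sheafRel_twist_of g (fun k hk => (mem_heckeSubgroup_iff.mp hk).2) h

end Holds

end Literature.NumberTheory.Kottwitz1992.HeckeCorrespondences
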